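import Summits.Schanuel.Schanuel.Theorems.ZilberEacGrowthExponent
import Summits.Schanuel.Schanuel.Theorems.ZilberEacExplosionDominance
import Summits.Schanuel.Schanuel.Theorems.ZilberEacRelationGeneral
import HarnessLib

/-!
# THEOREM I″: two coordinates on a super-scale with independent rates and one polynomial
# coordinate support no polynomial relation

Zilber's Exponential-Algebraic Closedness, case ladder (host summit Schanuel, cell `pub-schanuel`,
seat 2, gen 15).  The elimination engine prepared for the DOUBLE-CANCELLING regime (both fibres of
`{x₂ = r₀x₀ + r₁x₁ + c, yⱼ = xⱼ + y₂Fⱼ(y₂)}` — or of a 3-fold over a nonlinear base — solved by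
`xⱼ ≈ -y₂Fⱼ(y₂)` with `e^{xⱼ}` super-exponentially small; see HANDOFF O59 PLAN): along such a
family the multiplicative coordinates `y₀ = e^{x₀}`, `y₁ = e^{x₁}` satisfy
`log ‖yⱼ‖ = γⱼ T (1 + o(1))` on a scale `T → ∞` against which every polynomial quantity is
`e^{o(T)}`, while `‖y₂‖ → ∞` only polynomially.  THEOREM I (gen 8) and THEOREM I⁽ᵏ⁾ (gen 15) need
`O(1)` errors and injective weights on ALL coordinates; here the third coordinate has weight `0`.

* **`eventually_eval_ne_zero_of_twoScale`** — `H ≠ 0` in `ℂ[Y₀, Y₁, Y₂]`; `γ₀, γ₁` with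
  `aγ₀ + bγ₁` injective on `ℕ²`; `|log ‖y₀‖ - γ₀T| ≤ εT`, `|log ‖y₁‖ - γ₁T| ≤ εT` eventually for
  every `ε > 0`; `‖y₂‖ → ∞` with `log ‖y₂‖ ≤ εT` eventually for every `ε > 0`.  Then
  `H(y₀, y₁, y₂) ≠ 0` for all large `m`: grouping the monomials by `(a, b)`, the class of maximal
  weight is `y₀^{a}y₁^{b}·G(y₂)` with `G ≠ 0` univariate, `‖G(y₂)‖ ≥ c > 0` eventually
  (`exists_eventually_norm_eval_ge`), and every other monomial is smaller by `e^{-(gap - O(ε))T}`.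
* **`unprojectedDense_of_twoScale`** — the density form over THEOREM H⁽ᵏ⁾
  (`unprojectedDense_of_no_relation`) for a variety of dimension `≤ 3` and three coordinates.

HONEST FRAMING: an elimination lemma (no existence statement); it serves explicit families inside
the OPEN cell `EC(3,2)`; NOT Schanuel's conjecture; EAC ⇏ SC.
-/

noncomputable section

open MvPolynomial Filter Topology
open Literature.NumberTheory.Transcendental Literature.ModelTheory.Zilber

set_option linter.dupNamespace false

namespace Summit.Schanuel.Schanuel.Theorems

section TwoScale

/-- `‖y‖ⁿ` between `e^{n(γ - ε)T}` and `e^{n(γ + ε)T}` when `|log ‖y‖ - γT| ≤ εT`. [folklore] -/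
theorem norm_pow_bounds_of_abs_log_sub_le {y : ℂ} (hy : y ≠ 0) {γ ε T : ℝ}
    (h : |Real.log ‖y‖ - γ * T| ≤ ε * T) (n : ℕ) :
    Real.exp ((n : ℝ) * (γ * T - ε * T)) ≤ ‖y‖ ^ n ∧
      ‖y‖ ^ n ≤ Real.exp ((n : ℝ) * (γ * T + ε * T)) := by
  have hpos : 0 < ‖y‖ := norm_pos_iff.2 hy
  have hpow : ‖y‖ ^ n = Real.exp ((n : ℝ) * Real.log ‖y‖) := by
    rw [Real.exp_nat_mul, Real.exp_log hpos]
  obtain ⟨hlo, hhi⟩ := abs_le.1 h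
  rw [hpow]
  constructor
  · exact Real.exp_le_exp.2 (mul_le_mul_of_nonneg_left (by linarith) (Nat.cast_nonneg n))
  · exact Real.exp_le_exp.2 (mul_le_mul_of_nonneg_left (by linarith) (Nat.cast_nonneg n))

/-- **THEOREM I″ (two super-scale coordinates with independent rates, one polynomial coordinate).**
See the module docstring. (new) -/
theorem eventually_eval_ne_zero_of_twoScale (H : MvPolynomial (Fin 3) ℂ) (hH : H ≠ 0)
    (γ₀ γ₁ : ℝ)
    (hind : ∀ a b a' b' : ℕ, (a : ℝ) * γ₀ + b * γ₁ = a' * γ₀ + b' * γ₁ → a = a' ∧ b = b')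
    {y : ℕ → Fin 3 → ℂ} {T : ℕ → ℝ} (hT : Tendsto T atTop atTop)
    (h0 : ∀ ε : ℝ, 0 < ε → ∀ᶠ m in atTop, y m 0 ≠ 0 ∧ |Real.log ‖y m 0‖ - γ₀ * T m| ≤ ε * T m)
    (h1 : ∀ ε : ℝ, 0 < ε → ∀ᶠ m in atTop, y m 1 ≠ 0 ∧ |Real.log ‖y m 1‖ - γ₁ * T m| ≤ ε * T m)
    (h2 : Tendsto (fun m => ‖y m 2‖) atTop atTop)
    (h2' : ∀ ε : ℝ, 0 < ε → ∀ᶠ m in atTop, Real.log ‖y m 2‖ ≤ ε * T m) :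
    ∀ᶠ m in atTop, eval (y m) H ≠ 0 := by
  classical
  set S := H.support with hS
  have hSne : S.Nonempty := Finset.nonempty_iff_ne_empty.2 fun h => hH (support_eq_empty.1 h)
  set w : (Fin 3 →₀ ℕ) → ℝ := fun d => (d 0 : ℝ) * γ₀ + (d 1 : ℝ) * γ₁ with hw
  obtain ⟨ds, hds, hmax⟩ := S.exists_max_image w hSne
  set P := S.filter (fun d => d 0 = ds 0 ∧ d 1 = ds 1) with hP
  set Q := S.filter (fun d => ¬ (d 0 = ds 0 ∧ d 1 = ds 1)) with hQ
  have hQlt : ∀ d ∈ Q, w d < w ds := by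
    intro d hd
    rw [hQ, Finset.mem_filter] at hd
    refine lt_of_le_of_ne (hmax d hd.1) fun h => hd.2 ?_
    exact hind _ _ _ _ h
  obtain ⟨g, hgpos, hgap⟩ : ∃ g : ℝ, 0 < g ∧ ∀ d ∈ Q, w d ≤ w ds - g := by
    by_cases hQe : Q.Nonempty
    · obtain ⟨d₂, hd₂, hmax₂⟩ := Q.exists_max_image w hQe
      refine ⟨w ds - w d₂, sub_pos.2 (hQlt d₂ hd₂), fun d hd => ?_⟩
      have := hmax₂ d hd
      linarith
    · refine ⟨1, one_pos, fun d hd => (hQe ⟨d, hd⟩).elim⟩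
  -- the univariate polynomial carried by the top class
  set G : Polynomial ℂ := ∑ d ∈ P, Polynomial.C (coeff d H) * Polynomial.X ^ (d 2) with hG
  have hPeq : ∀ d ∈ P, d 0 = ds 0 ∧ d 1 = ds 1 := fun d hd => (Finset.mem_filter.1 hd).2
  have hGne : G ≠ 0 := by
    intro hG0
    have hcoef : G.coeff (ds 2) = coeff ds H := by
      rw [hG, Polynomial.finsetSum_coeff, Finset.sum_eq_single ds]
      · simp
      · intro d hd hne
        have hd' := hPeq d hd
        have h2 : d 2 ≠ ds 2 := by
          intro h2
          apply hne
          ext i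
          fin_cases i
          · exact hd'.1
          · exact hd'.2
          · exact h2
        simp [Polynomial.coeff_X_pow, Ne.symm h2]
      · intro hds'
        exact absurd (Finset.mem_filter.2 ⟨hds, rfl, rfl⟩) hds'
    rw [hG0, Polynomial.coeff_zero] at hcoef
    exact (mem_support_iff.1 hds) hcoef.symm
  obtain ⟨c, hcpos, hGlow⟩ := exists_eventually_norm_eval_ge G hGne (z := fun m => y m 2) h2
  -- degree data and the tolerance `ε`
  set A : ℕ := S.sup (fun d => d 0 + d 1) with hA
  set D : ℕ := S.sup (fun d => d 2) with hD
  have hAd : ∀ d ∈ S, d 0 + d 1 ≤ A := fun d hd => Finset.le_sup (f := fun d : Fin 3 →₀ ℕ => d 0 + d 1) hd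
  have hDd : ∀ d ∈ S, d 2 ≤ D := fun d hd => Finset.le_sup (f := fun d : Fin 3 →₀ ℕ => d 2) hd
  set ε : ℝ := g / (4 * ((2 * A : ℝ) + D + 1)) with hε
  have hεpos : 0 < ε := by positivity
  have hεsmall : ((2 * A : ℝ) + D) * ε ≤ g / 4 := by
    rw [hε]
    have hpos : (0 : ℝ) < (2 * A : ℝ) + D + 1 := by positivity
    rw [show ((2 * A : ℝ) + D) * (g / (4 * ((2 * A : ℝ) + D + 1))) =
      g / 4 * (((2 * A : ℝ) + D) / ((2 * A : ℝ) + D + 1)) by field_simp]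
    have : ((2 * A : ℝ) + D) / ((2 * A : ℝ) + D + 1) ≤ 1 := by
      rw [div_le_one hpos]; linarith
    nlinarith
  set Cs : ℝ := ∑ d ∈ Q, ‖coeff d H‖ with hCs
  -- the decisive decay `Cs e^{-(g/2) T} < c` eventually
  have hdecay : ∀ᶠ m in atTop, Cs * Real.exp (-(g / 2) * T m) < c := by
    have h1 : Tendsto (fun m => Cs * Real.exp (-(g / 2) * T m)) atTop (𝓝 (Cs * 0)) :=
      (Real.tendsto_exp_atBot.comp (hT.const_mul_atTop_of_neg (by linarith))).const_mul Cs
    rw [mul_zero] at h1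
    exact h1.eventually (gt_mem_nhds hcpos)
  filter_upwards [h0 ε hεpos, h1 ε hεpos, h2' ε hεpos, hGlow, hdecay, hT.eventually_ge_atTop 0,
    h2.eventually_ge_atTop 1] with m hm0 hm1 hm2 hmG hmdec hTm hy2
  obtain ⟨hy0, hl0⟩ := hm0
  obtain ⟨hy1, hl1⟩ := hm1
  have hy2' : y m 2 ≠ 0 := by
    intro h; rw [h, norm_zero] at hy2; linarith
  -- split the evaluation
  rw [MvPolynomial.eval_eq', ← Finset.sum_filter_add_sum_filter_not S (fun d => d 0 = ds 0 ∧ d 1 = ds 1)]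
  have hmain : ∑ d ∈ P, coeff d H * ∏ i, y m i ^ d i =
      y m 0 ^ ds 0 * y m 1 ^ ds 1 * G.eval (y m 2) := by
    rw [hG, Polynomial.eval_finsetSum, Finset.mul_sum]
    refine Finset.sum_congr rfl fun d hd => ?_
    obtain ⟨hd0, hd1⟩ := hPeq d hd
    rw [Fin.prod_univ_three, hd0, hd1, Polynomial.eval_mul, Polynomial.eval_C, Polynomial.eval_pow,
      Polynomial.eval_X]
    ring
  rw [← hP, ← hQ, hmain]
  -- lower bound for the main term
  have hTε : 0 ≤ ε * T m := mul_nonneg hεpos.le hTm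
  have hmain_lo : c * Real.exp (w ds * T m - (A : ℝ) * (ε * T m)) ≤
      ‖y m 0 ^ ds 0 * y m 1 ^ ds 1 * G.eval (y m 2)‖ := by
    rw [norm_mul, norm_mul, norm_pow, norm_pow]
    have b0 := (norm_pow_bounds_of_abs_log_sub_le hy0 hl0 (ds 0)).1
    have b1 := (norm_pow_bounds_of_abs_log_sub_le hy1 hl1 (ds 1)).1
    have hAds : ((ds 0 : ℕ) : ℝ) + ds 1 ≤ A := by exact_mod_cast hAd ds hds
    have hexp : Real.exp (w ds * T m - (A : ℝ) * (ε * T m)) ≤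
        Real.exp ((ds 0 : ℝ) * (γ₀ * T m - ε * T m)) * Real.exp ((ds 1 : ℝ) * (γ₁ * T m - ε * T m)) := by
      rw [← Real.exp_add]
      refine Real.exp_le_exp.2 ?_
      rw [hw]
      simp only
      nlinarith
    calc c * Real.exp (w ds * T m - (A : ℝ) * (ε * T m))
        ≤ c * (Real.exp ((ds 0 : ℝ) * (γ₀ * T m - ε * T m)) *
            Real.exp ((ds 1 : ℝ) * (γ₁ * T m - ε * T m))) :=
          mul_le_mul_of_nonneg_left hexp hcpos.le
      _ ≤ ‖G.eval (y m 2)‖ * (‖y m 0‖ ^ ds 0 * ‖y m 1‖ ^ ds 1) := by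
          refine mul_le_mul hmG (mul_le_mul b0 b1 (Real.exp_pos _).le (by positivity))
            (by positivity) (norm_nonneg _)
      _ = ‖y m 0‖ ^ ds 0 * ‖y m 1‖ ^ ds 1 * ‖Polynomial.eval (y m 2) G‖ := by ring
  -- upper bound for the rest
  have hrest : ∑ d ∈ Q, ‖coeff d H * ∏ i, y m i ^ d i‖ ≤
      Cs * Real.exp ((w ds - g) * T m + ((A : ℝ) + D) * (ε * T m)) := by
    rw [hCs, Finset.sum_mul]
    refine Finset.sum_le_sum fun d hd => ?_
    have hdS : d ∈ S := (Finset.mem_filter.1 hd).1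
    rw [norm_mul, norm_prod, Fin.prod_univ_three, norm_pow, norm_pow, norm_pow]
    refine mul_le_mul_of_nonneg_left ?_ (norm_nonneg _)
    have b0 := (norm_pow_bounds_of_abs_log_sub_le hy0 hl0 (d 0)).2
    have b1 := (norm_pow_bounds_of_abs_log_sub_le hy1 hl1 (d 1)).2
    have b2 : ‖y m 2‖ ^ d 2 ≤ Real.exp ((d 2 : ℝ) * (ε * T m)) := by
      rw [Real.exp_nat_mul]
      exact pow_le_pow_left₀ (norm_nonneg _) (by
        calc ‖y m 2‖ = Real.exp (Real.log ‖y m 2‖) := (Real.exp_log (by linarith)).symm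
          _ ≤ Real.exp (ε * T m) := Real.exp_le_exp.2 hm2) _
    have hAd' : ((d 0 : ℕ) : ℝ) + d 1 ≤ A := by exact_mod_cast hAd d hdS
    have hDd' : ((d 2 : ℕ) : ℝ) ≤ D := by exact_mod_cast hDd d hdS
    have hwd : w d ≤ w ds - g := hgap d hd
    calc ‖y m 0‖ ^ d 0 * ‖y m 1‖ ^ d 1 * ‖y m 2‖ ^ d 2
        ≤ Real.exp ((d 0 : ℝ) * (γ₀ * T m + ε * T m)) * Real.exp ((d 1 : ℝ) * (γ₁ * T m + ε * T m)) *
            Real.exp ((d 2 : ℝ) * (ε * T m)) :=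
          mul_le_mul (mul_le_mul b0 b1 (by positivity) (Real.exp_pos _).le) b2 (by positivity)
            (by positivity)
      _ = Real.exp (w d * T m + (((d 0 : ℕ) : ℝ) + d 1 + d 2) * (ε * T m)) := by
          rw [← Real.exp_add, ← Real.exp_add, hw]
          congr 1
          simp only
          ring
      _ ≤ Real.exp ((w ds - g) * T m + ((A : ℝ) + D) * (ε * T m)) := by
          refine Real.exp_le_exp.2 ?_
          nlinarith
  -- compare
  have hlt : ∑ d ∈ Q, ‖coeff d H * ∏ i, y m i ^ d i‖ <
      ‖y m 0 ^ ds 0 * y m 1 ^ ds 1 * G.eval (y m 2)‖ := by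
    refine lt_of_le_of_lt hrest (lt_of_lt_of_le ?_ hmain_lo)
    -- `Cs e^{(w*-g)T + (A+D)εT} < c e^{w*T - AεT}`  ⟸  `Cs e^{-(g/2)T} < c`
    have hkey : (w ds - g) * T m + ((A : ℝ) + D) * (ε * T m) ≤
        -(g / 2) * T m + (w ds * T m - (A : ℝ) * (ε * T m)) := by
      have : ((2 * A : ℝ) + D) * (ε * T m) ≤ g / 4 * T m := by
        have := mul_le_mul_of_nonneg_right hεsmall hTm
        linarith [this]
      nlinarith
    calc Cs * Real.exp ((w ds - g) * T m + ((A : ℝ) + D) * (ε * T m))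
        ≤ Cs * Real.exp (-(g / 2) * T m + (w ds * T m - (A : ℝ) * (ε * T m))) :=
          mul_le_mul_of_nonneg_left (Real.exp_le_exp.2 hkey) (by positivity)
      _ = Cs * Real.exp (-(g / 2) * T m) * Real.exp (w ds * T m - (A : ℝ) * (ε * T m)) := by
          rw [Real.exp_add]; ring
      _ < c * Real.exp (w ds * T m - (A : ℝ) * (ε * T m)) :=
          mul_lt_mul_of_pos_right hmdec (Real.exp_pos _)
  intro hzero
  have hsum : y m 0 ^ ds 0 * y m 1 ^ ds 1 * G.eval (y m 2) =
      -(∑ d ∈ Q, coeff d H * ∏ i, y m i ^ d i) := eq_neg_of_add_eq_zero_left hzero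
  have : ‖y m 0 ^ ds 0 * y m 1 ^ ds 1 * G.eval (y m 2)‖ ≤
      ∑ d ∈ Q, ‖coeff d H * ∏ i, y m i ^ d i‖ := by
    rw [hsum, norm_neg]
    exact norm_sum_le _ _
  linarith

end TwoScale

/-! ## Density form -/

section Density

variable {n : ℕ}

/-- **THEOREM I″, density form.**  `S` irreducible closed with `dim S ≤ 3`, three coordinates
`c₀, c₁, c₂`, and a sequence of exponential points of `S` whose `c₀, c₁`-coordinates lie on a
super-scale with independent rates and whose `c₂`-coordinate tends to infinity polynomially slower:
then `I(S ∩ Γ_exp) = I(S)`. (new) -/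
theorem unprojectedDense_of_twoScale {S : Set (Fin n ⊕ Fin n → ℂ)} (hS : IsIrreducibleClosed ℂ S)
    (hdim : zariskiDim ℂ S ≤ ((2 + 1 : ℕ) : WithBot ℕ∞)) (c : Fin 3 → Fin n ⊕ Fin n)
    {p : ℕ → Fin n ⊕ Fin n → ℂ} (hp : ∀ᶠ m in atTop, p m ∈ S ∧ p m ∈ expGraph ℂ n)
    (γ₀ γ₁ : ℝ)
    (hind : ∀ a b a' b' : ℕ, (a : ℝ) * γ₀ + b * γ₁ = a' * γ₀ + b' * γ₁ → a = a' ∧ b = b')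
    {T : ℕ → ℝ} (hT : Tendsto T atTop atTop)
    (h0 : ∀ ε : ℝ, 0 < ε → ∀ᶠ m in atTop, p m (c 0) ≠ 0 ∧ |Real.log ‖p m (c 0)‖ - γ₀ * T m| ≤ ε * T m)
    (h1 : ∀ ε : ℝ, 0 < ε → ∀ᶠ m in atTop, p m (c 1) ≠ 0 ∧ |Real.log ‖p m (c 1)‖ - γ₁ * T m| ≤ ε * T m)
    (h2 : Tendsto (fun m => ‖p m (c 2)‖) atTop atTop)
    (h2' : ∀ ε : ℝ, 0 < ε → ∀ᶠ m in atTop, Real.log ‖p m (c 2)‖ ≤ ε * T m) :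
    UnprojectedDense S := by
  refine unprojectedDense_of_no_relation hS hdim c fun H hH => ?_
  have hev := eventually_eval_ne_zero_of_twoScale H hH γ₀ γ₁ hind (y := fun m i => p m (c i)) hT
    h0 h1 h2 h2'
  obtain ⟨m, hmS, hne⟩ := (hp.and hev).exists
  exact ⟨p m, hmS, hne⟩

end Density

end Summit.Schanuel.Schanuel.Theorems

end
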